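import Summits.NavierStokesRegularity.NavierStokesRegularity.Theorems.AxisTwistDoorAveragedConeLiouvilleNUWeakDefs
import Summits.NavierStokesRegularity.NavierStokesRegularity.Theorems.AxisTwistDoorAveragedConeLiouvilleNUDriftTransfer
import Literature.Analysis.FluidPDE.Seregin2020SwirlEnergyInequality
import HarnessLib

/-!
# Route `AxisTwistDoor`, crux `AveragedConeLiouville` (stmt-NavierStokesRegularity-26889) — INPUT N4 / T1, piece W (N-W part 2),
# brick (b): THE `NUEnergyClass`-SHAPED ENERGY INEQUALITY FOR THE WEAK LIPSCHITZ DATA ON `]0,T[ × B(0,1)`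

T1 kit `kits/N4-T1-skeleton.lean` 118454bf17607d1e; tree texts `…NUWeakDefs` (p639785).  From W1 (`Sig.nu_weakEnergyIdentity`,
taken as a HYPOTHESIS — it is the antecedent of the kit's stub `Sig.nu_weakEnergyIdentity → Sig.nu_standing_of_weak`), the drift
transfer (b1) `nu_drift_transfer` and the pointwise absorption `2|H′||Θ||∇V||∇Θ| ≤ ½H″|∇V|²Θ² + 4H|∇Θ|²` (from `H′² ≤ 2HH″`):

* `nu_energyIneq_of_weak` — for the typed weak data and every `H ∈ C²` with `H′ ≤ 0 ≤ H`, `H″ ≥ 0`, `H′² ≤ 2HH″`, every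
  `Θ ∈ C¹_c` with `tsupport Θ ⊆ B(0,ρ₀)`, `ρ₀ < 1`, every `η ∈ C¹`, `η ≥ 0`, and `0 < t₁ ≤ t₂ < T`:
  `ofReal(η(t₂)M(t₂)) + ∫⁻ ofReal(½ηH″(V)|∇V|²Θ²) ≤ ofReal(η(t₁)M(t₁) + 4∫∫ηH(V)|∇Θ|² + ∫∫ηH(V)⟪b,∇Θ²⟫ + ∫∫|η′|H(V)Θ²)`
  — VERBATIM the inequality of `NUEnergyClass` (`…NUDefs`) with `(Φ,U)` the data `(V,b)` and the window `]0,T[`, `B(0,ρ₀)`.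
  This is the TEXT consumed by brick (c) (frames, ns-in-ser-a g3).

No NS statement is touched; T1 is an INPUT; item 26889 and the summit are not affected.
`--supports stmt-NavierStokesRegularity-26889 --as helper`. [cite: NazarovUraltseva2011HarnackDivFree, §3 (arXiv:1011.1888 p. 8)]
-/

noncomputable section

-- the summit and its single sub-problem share the name (CONVENTIONS §1)
set_option linter.dupNamespace false

open MeasureTheory Set Function Filter Topology Metric
open scoped NNReal ENNReal InnerProductSpace RealInnerProductSpace

namespace Summit.NavierStokesRegularity.NavierStokesRegularity.Theorems.AveragedConeLiouville.NUPositivity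

/-! ### Pointwise absorption -/

/-- `4|h₁|XY ≤ h₂X² + 8h₀Y²` whenever `h₁² ≤ 2h₀h₂`, `h₀, h₂, X, Y ≥ 0` (the Cauchy–Schwarz/Young step of the energy estimate,
with the structural inequality `H′² ≤ 2HH″` of the admissible `H`). [folklore] -/
theorem absorb_aux {h₀ h₁ h₂ : ℝ} (X Y : ℝ) (hh₀ : 0 ≤ h₀) (hh₂ : 0 ≤ h₂) (hsq : h₁ ^ 2 ≤ 2 * h₀ * h₂) :
    4 * |h₁| * X * Y ≤ h₂ * X ^ 2 + 8 * h₀ * Y ^ 2 := by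
  have hab : |h₁| ^ 2 ≤ 2 * h₀ * h₂ := by rwa [sq_abs]
  have ha : 0 ≤ |h₁| := abs_nonneg _
  rcases hh₂.eq_or_lt with h | h
  · rw [← h] at hab ⊢
    have : |h₁| = 0 := by nlinarith
    rw [this]; nlinarith
  · have key : h₂ * (4 * |h₁| * X * Y) ≤ h₂ * (h₂ * X ^ 2 + 8 * h₀ * Y ^ 2) := by
      nlinarith [sq_nonneg (h₂ * X - 2 * |h₁| * Y), sq_nonneg Y]
    exact le_of_mul_le_mul_left key h

/-- **The pointwise absorption of the cross term**: `−ηH′(v)⟪G,∇Θ²⟫ ≤ ½ηH″(v)‖G‖²Θ² + 4ηH(v)‖∇Θ‖²`. [folklore] -/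
theorem absorb_pointwise {H : ℝ → ℝ} (hH0 : ∀ v, 0 ≤ H v) (hH2 : ∀ v, 0 ≤ deriv (deriv H) v)
    (hsq : ∀ v, deriv H v ^ 2 ≤ 2 * H v * deriv (deriv H) v)
    {Θ : EuclideanSpace ℝ (Fin 3) → ℝ} (hΘ : ContDiff ℝ 1 Θ) {e : ℝ} (he : 0 ≤ e) (v : ℝ)
    (G : EuclideanSpace ℝ (Fin 3)) (x : EuclideanSpace ℝ (Fin 3)) :
    -(e * (deriv H v * ⟪G, gradient (fun y => Θ y ^ 2) x⟫)) ≤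
      1 / 2 * e * (deriv (deriv H) v * ‖G‖ ^ 2 * Θ x ^ 2) + 4 * (e * (H v * ‖gradient Θ x‖ ^ 2)) := by
  rw [Literature.Analysis.FluidPDE.Seregin2020.gradient_sq_apply hΘ, inner_smul_right]
  have hcs : |⟪G, gradient Θ x⟫| ≤ ‖G‖ * ‖gradient Θ x‖ := abs_real_inner_le_norm _ _
  have hab := absorb_aux (‖G‖ * |Θ x|) ‖gradient Θ x‖ (hH0 v) (hH2 v) (hsq v)
  have h1 : -(deriv H v * (2 * Θ x * ⟪G, gradient Θ x⟫)) ≤ 2 * |deriv H v| * (‖G‖ * |Θ x|) * ‖gradient Θ x‖ := by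
    have : |deriv H v * (2 * Θ x * ⟪G, gradient Θ x⟫)| = 2 * |deriv H v| * |Θ x| * |⟪G, gradient Θ x⟫| := by
      rw [abs_mul, abs_mul, abs_mul, abs_two]; ring
    have h2 : -(deriv H v * (2 * Θ x * ⟪G, gradient Θ x⟫)) ≤ |deriv H v * (2 * Θ x * ⟪G, gradient Θ x⟫)| :=
      neg_le_abs _
    rw [this] at h2
    refine h2.trans ?_
    have : 2 * |deriv H v| * |Θ x| * |⟪G, gradient Θ x⟫| ≤ 2 * |deriv H v| * |Θ x| * (‖G‖ * ‖gradient Θ x‖) :=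
      mul_le_mul_of_nonneg_left hcs (by positivity)
    refine this.trans (le_of_eq ?_)
    ring
  have hsq' : (‖G‖ * |Θ x|) ^ 2 = ‖G‖ ^ 2 * Θ x ^ 2 := by rw [mul_pow, sq_abs]
  rw [hsq'] at hab
  rw [← mul_neg, show -(deriv H v * (2 * Θ x * ⟪G, gradient Θ x⟫)) = -(deriv H v * (2 * Θ x * ⟪G, gradient Θ x⟫)) from rfl]
  nlinarith [h1, hab, he, mul_nonneg he (le_refl 0)]

/-! ### Integrability on time slabs -/

/-- From integrability on `W` to integrability on `[t₁,t₂] × ℝ³` for functions vanishing off the unit ball. [folklore] -/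
theorem integrableOn_Icc_univ_of_W {T t₁ t₂ : ℝ} (h0 : 0 < t₁) (hT : t₂ < T)
    {F : ℝ × EuclideanSpace ℝ (Fin 3) → ℝ}
    (hF : IntegrableOn F (Ioo 0 T ×ˢ ball (0 : EuclideanSpace ℝ (Fin 3)) 1) volume)
    (hF0 : ∀ p : ℝ × EuclideanSpace ℝ (Fin 3), p.2 ∉ ball (0 : EuclideanSpace ℝ (Fin 3)) 1 → F p = 0) :
    IntegrableOn F (Icc t₁ t₂ ×ˢ (univ : Set (EuclideanSpace ℝ (Fin 3)))) volume := by
  refine hF.of_ae_sdiff_eq_zero (measurableSet_Icc.prod MeasurableSet.univ).nullMeasurableSet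
    (ae_of_all _ fun p hp => hF0 p fun h => hp.2 ⟨⟨h0.trans_le hp.1.1.1, hp.1.1.2.trans_lt hT⟩, h⟩)

/-- **Brick (b) of W: the energy inequality of the class `NUEnergyClass` for the weak Lipschitz data on `]0,T[ × B(0,1)`**
(W1 + drift transfer + pointwise absorption). [cite: NazarovUraltseva2011HarnackDivFree, §3 (arXiv:1011.1888 p. 8)] -/
theorem nu_energyIneq_of_weak (hW1 : Sig.nu_weakEnergyIdentity) {T : ℝ} {V : ℝ → EuclideanSpace ℝ (Fin 3) → ℝ}
    {b : ℝ → EuclideanSpace ℝ (Fin 3) → EuclideanSpace ℝ (Fin 3)} {Λ : ℝ}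
    (hbm : Measurable (uncurry b))
    (hbΛ : ∀ t ∈ Ioo 0 T, ∀ x ∈ ball (0 : EuclideanSpace ℝ (Fin 3)) 1, ‖b t x‖ ≤ Λ)
    (hdiv : ∀ φ : ℝ → EuclideanSpace ℝ (Fin 3) → ℝ, ContDiff ℝ (⊤ : ℕ∞) (uncurry φ) →
        HasCompactSupport (uncurry φ) →
        tsupport (uncurry φ) ⊆ Ioo 0 T ×ˢ ball (0 : EuclideanSpace ℝ (Fin 3)) 1 →
        ∫ p in Ioo 0 T ×ˢ ball (0 : EuclideanSpace ℝ (Fin 3)) 1,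
          inner ℝ (b p.1 p.2) (gradient (φ p.1) p.2) = 0)
    (hVlip : ∃ L, LipschitzOnWith L (uncurry V) (Ioo 0 T ×ˢ ball (0 : EuclideanSpace ℝ (Fin 3)) 1))
    (hV0 : ∀ t ∈ Ioo 0 T, ∀ x ∈ ball (0 : EuclideanSpace ℝ (Fin 3)) 1, 0 ≤ V t x)
    (hweak : ∀ η : ℝ → EuclideanSpace ℝ (Fin 3) → ℝ, (∃ K, LipschitzWith K (uncurry η)) → (∀ t x, 0 ≤ η t x) →
        (∃ ρ τ : ℝ, ρ < 1 ∧ 0 < τ ∧ ∀ t x, (ρ ≤ ‖x‖ ∨ t ≤ τ) → η t x = 0) →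
        0 ≤ ∫ p in Ioo 0 T ×ˢ ball (0 : EuclideanSpace ℝ (Fin 3)) 1,
          (deriv (fun s => V s p.2) p.1 * η p.1 p.2 +
            inner ℝ (gradient (V p.1) p.2) (gradient (η p.1) p.2) +
            inner ℝ (b p.1 p.2) (gradient (V p.1) p.2) * η p.1 p.2)) :
    ∀ (H : ℝ → ℝ), ContDiff ℝ 2 H → (∀ v, deriv H v ≤ 0) → (∀ v, 0 ≤ H v) →
      (∀ v, 0 ≤ deriv (deriv H) v) → (∀ v, deriv H v ^ 2 ≤ 2 * H v * deriv (deriv H) v) →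
    ∀ (Θ : EuclideanSpace ℝ (Fin 3) → ℝ), ContDiff ℝ 1 Θ → HasCompactSupport Θ →
    ∀ (ρ₀ : ℝ), ρ₀ < 1 → tsupport Θ ⊆ ball (0 : EuclideanSpace ℝ (Fin 3)) ρ₀ →
    ∀ (η : ℝ → ℝ), ContDiff ℝ 1 η → (∀ s, 0 ≤ η s) →
    ∀ (t₁ t₂ : ℝ), 0 < t₁ → t₁ ≤ t₂ → t₂ < T →
      ENNReal.ofReal (η t₂ * ∫ x, H (V t₂ x) * Θ x ^ 2) +
        ∫⁻ z in Icc t₁ t₂ ×ˢ (univ : Set (EuclideanSpace ℝ (Fin 3))), ENNReal.ofReal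
          (1 / 2 * η z.1 * (deriv (deriv H) (V z.1 z.2) * ‖gradient (V z.1) z.2‖ ^ 2 * Θ z.2 ^ 2))
      ≤ ENNReal.ofReal (η t₁ * (∫ x, H (V t₁ x) * Θ x ^ 2) +
          (4 * ∫ z in Icc t₁ t₂ ×ˢ (univ : Set (EuclideanSpace ℝ (Fin 3))),
            η z.1 * (H (V z.1 z.2) * ‖gradient Θ z.2‖ ^ 2)) +
          (∫ z in Icc t₁ t₂ ×ˢ (univ : Set (EuclideanSpace ℝ (Fin 3))),
            η z.1 * (H (V z.1 z.2) * inner ℝ (b z.1 z.2) (gradient (fun y => Θ y ^ 2) z.2))) +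
          (∫ z in Icc t₁ t₂ ×ˢ (univ : Set (EuclideanSpace ℝ (Fin 3))),
            |deriv η z.1| * (H (V z.1 z.2) * Θ z.2 ^ 2))) := by
  intro H hH hH' hH0 hH2 hHsq Θ hΘ hΘc ρ₀ hρ₀ hΘρ η hη hη0 t₁ t₂ h0 h12 hT
  set W : Set (ℝ × EuclideanSpace ℝ (Fin 3)) := Ioo 0 T ×ˢ ball (0 : EuclideanSpace ℝ (Fin 3)) 1 with hWdef
  have hWo : IsOpen W := isOpen_Ioo.prod isOpen_ball
  have hWm : MeasurableSet W := hWo.measurableSet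
  have hWc : IsCompact (Icc 0 T ×ˢ closedBall (0 : EuclideanSpace ℝ (Fin 3)) 1) :=
    isCompact_Icc.prod (isCompact_closedBall _ _)
  have hWsub : W ⊆ Icc 0 T ×ˢ closedBall (0 : EuclideanSpace ℝ (Fin 3)) 1 :=
    Set.prod_mono Ioo_subset_Icc_self ball_subset_closedBall
  have hWfin : volume W < ∞ := (measure_mono hWsub).trans_lt hWc.measure_lt_top
  haveI : IsFiniteMeasure (volume.restrict W) := ⟨by rw [Measure.restrict_apply_univ]; exact hWfin⟩
  haveI : (volume : Measure (ℝ × EuclideanSpace ℝ (Fin 3))).IsAddHaarMeasure := by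
    rw [Measure.volume_eq_prod]; infer_instance
  -- (I) W1, (II) the drift transfer
  have hI := hW1 T V b hbm ⟨Λ, hbΛ⟩ hVlip hV0 hweak H hH hH' hH0 Θ hΘ hΘc ρ₀ hρ₀ hΘρ η hη hη0 t₁ t₂ h0 h12 hT
  have hII := nu_drift_transfer hbm hbΛ hdiv hVlip hH hΘ hΘc hρ₀ hΘρ hη h0 h12 hT
  -- the Lipschitz extension and the Rademacher set
  obtain ⟨L, hL⟩ := hVlip
  obtain ⟨g, hg, hVg⟩ := hL.extend_real
  have hVgp : ∀ p ∈ W, V p.1 p.2 = g p := fun p hp => by have := hVg hp; simpa [uncurry] using this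
  have hae : ∀ᵐ p ∂(volume.restrict W), p ∈ W ∧ DifferentiableAt ℝ g p :=
    (ae_restrict_mem hWm).and (ae_restrict_of_ae (hg.ae_differentiableAt (μ := volume)))
  -- supports
  have hΘ0 : ∀ x, x ∉ ball (0 : EuclideanSpace ℝ (Fin 3)) 1 → Θ x = 0 := fun x hx =>
    image_eq_zero_of_notMem_tsupport fun h => hx (ball_subset_ball hρ₀.le (hΘρ h))
  have hgradΘ0' : ∀ x, x ∉ ball (0 : EuclideanSpace ℝ (Fin 3)) 1 → gradient Θ x = 0 := by
    intro x hx
    have hx' : x ∉ tsupport Θ := fun h => hx (ball_subset_ball hρ₀.le (hΘρ h))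
    rw [gradient, fderiv_of_notMem_tsupport ℝ hx', map_zero]
  have hgradΘ0 : ∀ x, x ∉ ball (0 : EuclideanSpace ℝ (Fin 3)) 1 → gradient (fun y => Θ y ^ 2) x = 0 := by
    intro x hx
    rw [Literature.Analysis.FluidPDE.Seregin2020.gradient_sq_apply hΘ, hgradΘ0' x hx, smul_zero]
  -- bounds for the `C`-integrand model
  obtain ⟨Mg, hMg⟩ := hWc.exists_bound_of_continuousOn hg.continuous.continuousOn
  obtain ⟨MH, hMH⟩ := isCompact_Icc.exists_bound_of_continuousOn (hH.continuous.continuousOn (s := Icc (-Mg) Mg))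
  have hgK : ∀ p ∈ W, g p ∈ Icc (-Mg) Mg := fun p hp =>
    abs_le.mp ((Real.norm_eq_abs _).symm.le.trans (hMg p (hWsub hp)))
  obtain ⟨Cη, hCη⟩ := isCompact_Icc.exists_bound_of_continuousOn (hη.continuous.continuousOn (s := Icc 0 T))
  have hgradc : Continuous (gradient Θ) := by
    have e : gradient Θ = fun x => (InnerProductSpace.toDual ℝ (EuclideanSpace ℝ (Fin 3))).symm (fderiv ℝ Θ x) := rfl
    rw [e]
    exact (InnerProductSpace.toDual ℝ (EuclideanSpace ℝ (Fin 3))).symm.continuous.comp (hΘ.continuous_fderiv one_ne_zero)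
  obtain ⟨BΘ, hBΘ⟩ := (hΘc.fderiv (𝕜 := ℝ)).exists_bound_of_continuous (hΘ.continuous_fderiv one_ne_zero)
  -- the three integrands
  set fA : ℝ × EuclideanSpace ℝ (Fin 3) → ℝ := fun z =>
    η z.1 * (deriv (deriv H) (V z.1 z.2) * ‖gradient (V z.1) z.2‖ ^ 2 * Θ z.2 ^ 2) with hfA
  set fB : ℝ × EuclideanSpace ℝ (Fin 3) → ℝ := fun z =>
    η z.1 * (deriv H (V z.1 z.2) * ⟪gradient (V z.1) z.2, gradient (fun y => Θ y ^ 2) z.2⟫) with hfB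
  set fC : ℝ × EuclideanSpace ℝ (Fin 3) → ℝ := fun z =>
    η z.1 * (H (V z.1 z.2) * ‖gradient Θ z.2‖ ^ 2) with hfC
  obtain ⟨C, hC⟩ := nu_weak_pieces_bound hbΛ hg hVg hH hΘ hΘc hη.continuous
  obtain ⟨-, hmA, hmB, -⟩ := nu_weak_pieces_aesm (T := T) hbm hg hVg hH hΘ hη.continuous
  have hAW : IntegrableOn fA W volume := by
    refine Integrable.mono' (integrable_const C) hmA ?_
    filter_upwards [hae] with p hp
    rw [Real.norm_eq_abs]; exact (hC p hp.1 hp.2).2.1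
  have hBW : IntegrableOn fB W volume := by
    refine Integrable.mono' (integrable_const C) hmB ?_
    filter_upwards [hae] with p hp
    rw [Real.norm_eq_abs]; exact (hC p hp.1 hp.2).2.2.1
  have hCW : IntegrableOn fC W volume := by
    have hmod : AEStronglyMeasurable (fun z : ℝ × EuclideanSpace ℝ (Fin 3) =>
        η z.1 * (H (g z) * ‖gradient Θ z.2‖ ^ 2)) (volume.restrict W) :=
      (((hη.continuous.comp continuous_fst).mul ((hH.continuous.comp hg.continuous).mul
        ((hgradc.comp continuous_snd).norm.pow 2))).aestronglyMeasurable).restrict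
    have hm : AEStronglyMeasurable fC (volume.restrict W) := by
      refine hmod.congr ?_
      filter_upwards [ae_restrict_mem hWm] with p hp
      simp only [hfC, hVgp p hp]
    refine Integrable.mono' (integrable_const (Cη * (MH * BΘ ^ 2))) hm ?_
    filter_upwards [ae_restrict_mem hWm] with p hp
    have hp' : p.1 ∈ Ioo 0 T ∧ p.2 ∈ ball (0 : EuclideanSpace ℝ (Fin 3)) 1 := by
      rw [hWdef, mem_prod] at hp; exact hp
    rw [hfC]
    dsimp only
    rw [norm_mul, norm_mul, hVgp p hp, norm_pow, norm_norm]
    have h1 : ‖η p.1‖ ≤ Cη := hCη p.1 (Ioo_subset_Icc_self hp'.1)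
    have h2 : ‖H (g p)‖ ≤ MH := hMH _ (hgK p hp)
    have h3 : ‖gradient Θ p.2‖ ≤ BΘ := by rw [gradient, LinearIsometryEquiv.norm_map]; exact hBΘ p.2
    have hCη0 : 0 ≤ Cη := (norm_nonneg _).trans h1
    have hMH0 : 0 ≤ MH := (norm_nonneg _).trans h2
    exact mul_le_mul h1 (mul_le_mul h2 (pow_le_pow_left₀ (norm_nonneg _) h3 2) (by positivity) hMH0)
      (by positivity) hCη0
  have hAi : IntegrableOn fA (Icc t₁ t₂ ×ˢ (univ : Set (EuclideanSpace ℝ (Fin 3)))) volume :=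
    integrableOn_Icc_univ_of_W h0 hT hAW fun p hp => by simp only [hfA, hΘ0 p.2 hp]; ring
  have hBi : IntegrableOn fB (Icc t₁ t₂ ×ˢ (univ : Set (EuclideanSpace ℝ (Fin 3)))) volume :=
    integrableOn_Icc_univ_of_W h0 hT hBW fun p hp => by simp only [hfB, hgradΘ0 p.2 hp, inner_zero_right]; ring
  have hCi : IntegrableOn fC (Icc t₁ t₂ ×ˢ (univ : Set (EuclideanSpace ℝ (Fin 3)))) volume :=
    integrableOn_Icc_univ_of_W h0 hT hCW fun p hp => by simp only [hfC, hgradΘ0' p.2 hp, norm_zero]; ring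
  -- (III) absorption of the cross term
  set A : ℝ := ∫ z in Icc t₁ t₂ ×ˢ (univ : Set (EuclideanSpace ℝ (Fin 3))), fA z with hAdef
  set B : ℝ := ∫ z in Icc t₁ t₂ ×ˢ (univ : Set (EuclideanSpace ℝ (Fin 3))), fB z with hBdef
  set Cint : ℝ := ∫ z in Icc t₁ t₂ ×ˢ (univ : Set (EuclideanSpace ℝ (Fin 3))), fC z with hCdef
  have hIII : -B ≤ 1 / 2 * A + 4 * Cint := by
    have h1 : -B = ∫ z in Icc t₁ t₂ ×ˢ (univ : Set (EuclideanSpace ℝ (Fin 3))), -fB z := by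
      rw [integral_neg]
    have h2 : 1 / 2 * A + 4 * Cint =
        ∫ z in Icc t₁ t₂ ×ˢ (univ : Set (EuclideanSpace ℝ (Fin 3))), (1 / 2 * fA z + 4 * fC z) := by
      rw [integral_add (hAi.const_mul _) (hCi.const_mul _), integral_const_mul, integral_const_mul]
    rw [h1, h2]
    refine integral_mono hBi.neg ((hAi.const_mul _).add (hCi.const_mul _)) fun z => ?_
    have := absorb_pointwise hH0 hH2 hHsq hΘ (hη0 z.1) (V z.1 z.2) (gradient (V z.1) z.2) z.2
    simp only [hfA, hfB, hfC]
    linarith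
  -- nonnegativity
  have hM0 : ∀ t, 0 ≤ ∫ x, H (V t x) * Θ x ^ 2 := fun t =>
    integral_nonneg fun x => mul_nonneg (hH0 _) (sq_nonneg _)
  have hA0 : 0 ≤ A := by
    rw [hAdef]
    refine integral_nonneg fun z => ?_
    simp only [hfA]
    exact mul_nonneg (hη0 _) (mul_nonneg (mul_nonneg (hH2 _) (sq_nonneg _)) (sq_nonneg _))
  -- the real inequality
  have hreal : η t₂ * (∫ x, H (V t₂ x) * Θ x ^ 2) + 1 / 2 * A ≤
      η t₁ * (∫ x, H (V t₁ x) * Θ x ^ 2) + 4 * Cint +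
        (∫ z in Icc t₁ t₂ ×ˢ (univ : Set (EuclideanSpace ℝ (Fin 3))),
          η z.1 * (H (V z.1 z.2) * ⟪b z.1 z.2, gradient (fun y => Θ y ^ 2) z.2⟫)) +
        (∫ z in Icc t₁ t₂ ×ˢ (univ : Set (EuclideanSpace ℝ (Fin 3))), |deriv η z.1| * (H (V z.1 z.2) * Θ z.2 ^ 2)) := by
    linarith [hI, hII, hIII]
  -- the `lintegral` of the dissipation term
  have hlin : ∫⁻ z in Icc t₁ t₂ ×ˢ (univ : Set (EuclideanSpace ℝ (Fin 3))), ENNReal.ofReal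
      (1 / 2 * η z.1 * (deriv (deriv H) (V z.1 z.2) * ‖gradient (V z.1) z.2‖ ^ 2 * Θ z.2 ^ 2)) =
      ENNReal.ofReal (1 / 2 * A) := by
    have hnn : 0 ≤ᵐ[volume.restrict (Icc t₁ t₂ ×ˢ (univ : Set (EuclideanSpace ℝ (Fin 3))))] fun z => 1 / 2 * fA z := by
      refine ae_of_all _ fun z => ?_
      simp only [Pi.zero_apply, hfA]
      exact mul_nonneg (by norm_num) (mul_nonneg (hη0 _) (mul_nonneg (mul_nonneg (hH2 _) (sq_nonneg _)) (sq_nonneg _)))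
    have hconv := ofReal_integral_eq_lintegral_ofReal (hAi.const_mul (1 / 2)) hnn
    rw [hAdef, ← integral_const_mul, hconv]
    refine lintegral_congr fun z => ?_
    congr 1
    simp only [hfA]
    ring
  rw [hlin, ← ENNReal.ofReal_add (mul_nonneg (hη0 _) (hM0 _)) (by positivity)]
  exact ENNReal.ofReal_le_ofReal hreal

end Summit.NavierStokesRegularity.NavierStokesRegularity.Theorems.AveragedConeLiouville.NUPositivity

end
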